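import Literature.AlgebraicGeometry.Frobenioids.BiratPathsElem
import HarnessLib

/-!
# Frobenioids I, Theorem 5.2 (iv), proof step: the class of an `F_P`-path and the divisor of the
conjugated birational morphism

Mochizuki, *The geometry of Frobenioids I: the general theory*, Kyushu J. Math. **62** (2008)
293–400, §5, proof of Theorem 5.2 (iv), kurims text p. 102 [cite: MochizukiFrdI2008, Thm. 5.2(iv)
p.102]:
"to every object `C ∈ Ob(C)` equipped with an `F_P`-path `(ζ_A : B → A, ζ_C : B → C)`, we may
associate an object `(Base(A), Φ(ζ_A)⁻¹(Div(ζ_C) − Div(ζ_A)) ∈ Φ^gp(A))` of [the model Frobenioid]".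

Over `BiratPaths*.lean`: the class `cls p := Φ(ζ_A)⁻¹(Div ζ_X − Div ζ_A) ∈ Φ^gp(A_D)` of an
`F_P`-path `p` is the `Φ^gp`-divisor of the *path isomorphism* `π_p := (ζ_A^birat)⁻¹ ≫ ζ_X^birat =
[(ζ_A, ζ_X)]` of `C^birat`; the conjugated morphism is `pathHom φ = π_p ≫ φ^birat ≫ π_{p'}^rev`; and
its `Φ^gp`-divisor satisfies `(cls p)^{deg φ} · divOf φ = baseOf(φ)^*(cls p') · Div(pathHom φ)` —
precisely relation (d) `α^{deg} · Div = Base^*(α') · Div_B(u)` of the model Frobenioid (Thm. 5.2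
(i))
with `Div_B(u) := Div(pathHom φ)`: the unit entry of the comparison functor must be a rational
function with this divisor.  (`Birat.gpBase/gpDiv/gpDeg` read the `F_{Φ^gp}`-data of a birational
morphism between images of objects of `C` in the types of `C`, avoiding the type synonym.)
-/

namespace Literature.AlgebraicGeometry.Frobenioids

open CategoryTheory Opposite

universe w v v' u u'

namespace PreFrobenioid

variable {D : Type u} [Category.{v} D] {Φ : Dᵒᵖ ⥤ CommMonCat.{w}}
  {C : Type u'} [Category.{v'} C] {F : C ⥤ ElemFrobenioid Φ} {hF : IsFrobenioid F}
  {hsq : HasBiratSquares F}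

namespace Birat

/-! ### `F_{Φ^gp}`-data of birational morphisms between images of objects of `C` -/

/-- The base map of `f : A^birat → B^birat`, typed `Base A → Base B`. [cite: MochizukiFrdI2008,
Prop. 4.4(i) p.83] -/
noncomputable def gpBase {A B : C} (f : (toBirat F hF hsq).obj A ⟶ (toBirat F hF hsq).obj B) :
    baseObj F A ⟶ baseObj F B :=
  Base (toElemGp hF hsq) f

/-- The `Φ^gp`-divisor of `f : A^birat → B^birat`, typed in `Φ^gp(A_D)`. [cite: MochizukiFrdI2008,
Prop. 4.4(i) p.83] -/
noncomputable def gpDiv {A B : C} (f : (toBirat F hF hsq).obj A ⟶ (toBirat F hF hsq).obj B) :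
    PhiGp F A :=
  ElemFrobenioid.Div ((toElemGp hF hsq).map f)

/-- The Frobenius degree of `f : A^birat → B^birat`. [cite: MochizukiFrdI2008, Prop. 4.4(i) p.83] -/
noncomputable def gpDeg {A B : C} (f : (toBirat F hF hsq).obj A ⟶ (toBirat F hF hsq).obj B) : ℕ+ :=
  degFr (toElemGp hF hsq) f

/-- On the class of a fraction: `(base, divGp, deg)`. [cite: MochizukiFrdI2008, Prop. 4.4(i) p.84]
-/
theorem gpBase_homMk {A B : C} (f : BiratFrac F A B) :
    gpBase (homMk (X := (toBirat F hF hsq).obj A) (Y := (toBirat F hF hsq).obj B) f) = f.base := rfl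

/-- On the class of a fraction: `(base, divGp, deg)`. [cite: MochizukiFrdI2008, Prop. 4.4(i) p.84]
-/
theorem gpDiv_homMk {A B : C} (f : BiratFrac F A B) :
    gpDiv (homMk (X := (toBirat F hF hsq).obj A) (Y := (toBirat F hF hsq).obj B) f) = f.divGp := rfl

/-- On the class of a fraction: `(base, divGp, deg)`. [cite: MochizukiFrdI2008, Prop. 4.4(i) p.84]
-/
theorem gpDeg_homMk {A B : C} (f : BiratFrac F A B) :
    gpDeg (homMk (X := (toBirat F hF hsq).obj A) (Y := (toBirat F hF hsq).obj B) f) = f.deg := rfl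

/-- On the image of a morphism of `C`: `Base`. [cite: MochizukiFrdI2008, Prop. 4.4(i) p.83] -/
theorem gpBase_map {A B : C} (φ : A ⟶ B) : gpBase ((toBirat F hF hsq).map φ) = Base F φ :=
  BiratFrac.base_ofHom hF φ

/-- On the image of a morphism of `C`: `Div` in `Φ^gp`. [cite: MochizukiFrdI2008, Prop. 4.4(i)
p.83] -/
theorem gpDiv_map {A B : C} (φ : A ⟶ B) :
    gpDiv ((toBirat F hF hsq).map φ) = Algebra.GrothendieckGroup.of (Div F φ) :=
  BiratFrac.divGp_ofHom hF φ

/-- On the image of a morphism of `C`: `deg_Fr`. [cite: MochizukiFrdI2008, Prop. 4.4(i) p.83] -/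
theorem gpDeg_map {A B : C} (φ : A ⟶ B) : gpDeg ((toBirat F hF hsq).map φ) = degFr F φ := rfl

/-- The composition law of `F_{Φ^gp}` for `gpDiv`: `Div(f ≫ g) = Base(f)^* Div(g) · Div(f)^{deg g}`.
[cite: MochizukiFrdI2008, Def. 1.1(iii)] -/
theorem gpDiv_comp {A B E : C} (f : (toBirat F hF hsq).obj A ⟶ (toBirat F hF hsq).obj B)
    (g : (toBirat F hF hsq).obj B ⟶ (toBirat F hF hsq).obj E) :
    gpDiv (f ≫ g) = pullGp Φ (gpBase f) (gpDiv g) * gpDiv f ^ (gpDeg g : ℕ) := by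
  unfold gpDiv gpBase gpDeg
  rw [Functor.map_comp, ElemFrobenioid.div_comp]
  rfl

/-- `Base(f ≫ g) = Base f ≫ Base g`. [cite: MochizukiFrdI2008, Def. 1.1(iii)] -/
theorem gpBase_comp {A B E : C} (f : (toBirat F hF hsq).obj A ⟶ (toBirat F hF hsq).obj B)
    (g : (toBirat F hF hsq).obj B ⟶ (toBirat F hF hsq).obj E) :
    gpBase (f ≫ g) = gpBase f ≫ gpBase g :=
  base_comp (toElemGp hF hsq) f g

/-- `deg(f ≫ g) = deg f · deg g`. [cite: MochizukiFrdI2008, Def. 1.1(iii)] -/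
theorem gpDeg_comp {A B E : C} (f : (toBirat F hF hsq).obj A ⟶ (toBirat F hF hsq).obj B)
    (g : (toBirat F hF hsq).obj B ⟶ (toBirat F hF hsq).obj E) :
    gpDeg (f ≫ g) = gpDeg f * gpDeg g :=
  degFr_comp (toElemGp hF hsq) f g

end Birat

namespace FPPath

variable {P : Set C} {X X' : C}

/-- The path fraction `(ζ_A, ζ_X) : A ⇢ X`. [cite: MochizukiFrdI2008, Thm. 5.2(iv) p.102] -/
def frac (p : FPPath F P X) : BiratFrac F p.A X := ⟨p.B, p.ζA, p.ζX, p.ζA_mem⟩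

/-- The reversed path fraction `(ζ_X, ζ_A) : X ⇢ A`. [cite: MochizukiFrdI2008, Thm. 5.2(iv) p.102]
-/
def fracRev (p : FPPath F P X) : BiratFrac F X p.A := ⟨p.B, p.ζX, p.ζA, p.ζX_mem⟩

/-- **The class of an `F_P`-path**: `Φ(ζ_A)⁻¹(Div ζ_X − Div ζ_A) ∈ Φ^gp(A_D)` — the second component
of the model object `(Base(A), ·)` associated to `(X, p)`. [cite: MochizukiFrdI2008, Thm. 5.2(iv)
p.102] -/
noncomputable def cls (p : FPPath F P X) : PhiGp F p.A := BiratFrac.divGp p.frac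

/-- `cls p = Φ(ζ_A)⁻¹(Div ζ_X / Div ζ_A)` explicitly (`deg_Fr ζ_X = 1`).
[cite: MochizukiFrdI2008, Thm. 5.2(iv) p.102] -/
theorem cls_eq (p : FPPath F P X) :
    haveI : IsIso (Base F p.ζA) := p.ζA_mem.2.2
    cls p = pullGp Φ (inv (Base F p.ζA))
      (Algebra.GrothendieckGroup.of (Div F p.ζX) / Algebra.GrothendieckGroup.of (Div F p.ζA)) := by
  unfold cls BiratFrac.divGp BiratFrac.deg frac
  dsimp only
  rw [p.ζX_mem.2.1, PNat.one_coe, pow_one]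

variable (hF hsq) in
/-- The **path isomorphism** `π_p := (ζ_A^birat)⁻¹ ≫ ζ_X^birat : A^birat ⟶ X^birat`.
[cite: MochizukiFrdI2008, Thm. 5.2(iv) p.102] -/
noncomputable def pathIso (p : FPPath F P X) :
    (toBirat F hF hsq).obj p.A ⟶ (toBirat F hF hsq).obj X :=
  haveI := Birat.isIso_toBirat_map (hF := hF) (hsq := hsq) p.ζA p.ζA_mem
  inv ((toBirat F hF hsq).map p.ζA) ≫ (toBirat F hF hsq).map p.ζX

/-- `π_p = [(ζ_A, ζ_X)]`. [cite: MochizukiFrdI2008, Thm. 5.2(iv) p.102] -/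
theorem pathIso_eq_homMk (p : FPPath F P X) :
    pathIso hF hsq p = Birat.homMk (X := (toBirat F hF hsq).obj p.A)
      (Y := (toBirat F hF hsq).obj X) p.frac := by
  haveI := Birat.isIso_toBirat_map (hF := hF) (hsq := hsq) p.ζA p.ζA_mem
  unfold pathIso
  rw [IsIso.inv_comp_eq]
  exact (toBirat_map_den_comp_homMk hF hsq p.frac).symm

variable (hF hsq) in
/-- The reversed path isomorphism `π_p^rev := (ζ_X^birat)⁻¹ ≫ ζ_A^birat : X^birat ⟶ A^birat`.
[cite: MochizukiFrdI2008, Thm. 5.2(iv) p.102] -/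
noncomputable def pathIsoRev (p : FPPath F P X) :
    (toBirat F hF hsq).obj X ⟶ (toBirat F hF hsq).obj p.A :=
  haveI := Birat.isIso_toBirat_map (hF := hF) (hsq := hsq) p.ζX p.ζX_mem
  inv ((toBirat F hF hsq).map p.ζX) ≫ (toBirat F hF hsq).map p.ζA

/-- `π_p^rev = [(ζ_X, ζ_A)]`. [cite: MochizukiFrdI2008, Thm. 5.2(iv) p.102] -/
theorem pathIsoRev_eq_homMk (p : FPPath F P X) :
    pathIsoRev hF hsq p = Birat.homMk (X := (toBirat F hF hsq).obj X)
      (Y := (toBirat F hF hsq).obj p.A) p.fracRev := by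
  haveI := Birat.isIso_toBirat_map (hF := hF) (hsq := hsq) p.ζX p.ζX_mem
  unfold pathIsoRev
  rw [IsIso.inv_comp_eq]
  exact (toBirat_map_den_comp_homMk hF hsq p.fracRev).symm

/-- `pathHom φ = π_p ≫ φ^birat ≫ π_{p'}^rev`. [cite: MochizukiFrdI2008, Thm. 5.2(iv) p.102] -/
theorem pathHom_eq (p : FPPath F P X) (p' : FPPath F P X') (φ : X ⟶ X') :
    pathHom hF hsq p p' φ = pathIso hF hsq p ≫ (toBirat F hF hsq).map φ ≫ pathIsoRev hF hsq p' := by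
  unfold pathHom pathIso pathIsoRev
  simp only [Category.assoc]

/-- The `Φ^gp`-divisor of the path isomorphism is the class: `Div(π_p) = cls p`.
[cite: MochizukiFrdI2008, Thm. 5.2(iv) p.102] -/
theorem gpDiv_pathIso (p : FPPath F P X) : Birat.gpDiv (pathIso hF hsq p) = cls p := by
  rw [pathIso_eq_homMk, Birat.gpDiv_homMk]
  rfl

/-- `Base(π_p) = Base(ζ_A)⁻¹ ≫ Base(ζ_X)`. [cite: MochizukiFrdI2008, Thm. 5.2(iv) p.102] -/
theorem gpBase_pathIso (p : FPPath F P X) :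
    haveI : IsIso (Base F p.ζA) := p.ζA_mem.2.2
    Birat.gpBase (pathIso hF hsq p) = inv (Base F p.ζA) ≫ Base F p.ζX := by
  rw [pathIso_eq_homMk, Birat.gpBase_homMk]
  rfl

/-- `Div(π_p^rev) = Φ(ζ_X)⁻¹(Div ζ_A / Div ζ_X)`. [cite: MochizukiFrdI2008, Thm. 5.2(iv) p.102] -/
theorem gpDiv_pathIsoRev (p : FPPath F P X) :
    haveI : IsIso (Base F p.ζX) := p.ζX_mem.2.2
    Birat.gpDiv (pathIsoRev hF hsq p) = pullGp Φ (inv (Base F p.ζX))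
      (Algebra.GrothendieckGroup.of (Div F p.ζA) / Algebra.GrothendieckGroup.of (Div F p.ζX)) := by
  rw [pathIsoRev_eq_homMk, Birat.gpDiv_homMk]
  unfold BiratFrac.divGp BiratFrac.deg fracRev
  dsimp only
  rw [p.ζA_mem.2.1, PNat.one_coe, pow_one]

/-- `Base(π_p^rev) = Base(ζ_X)⁻¹ ≫ Base(ζ_A)`. [cite: MochizukiFrdI2008, Thm. 5.2(iv) p.102] -/
theorem gpBase_pathIsoRev (p : FPPath F P X) :
    haveI : IsIso (Base F p.ζX) := p.ζX_mem.2.2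
    Birat.gpBase (pathIsoRev hF hsq p) = inv (Base F p.ζX) ≫ Base F p.ζA := by
  rw [pathIsoRev_eq_homMk, Birat.gpBase_homMk]
  rfl

/-- `deg_Fr(π_p^rev) = 1`. [cite: MochizukiFrdI2008, Thm. 5.2(iv) p.102] -/
theorem gpDeg_pathIsoRev (p : FPPath F P X) : Birat.gpDeg (pathIsoRev hF hsq p) = 1 := by
  rw [pathIsoRev_eq_homMk, Birat.gpDeg_homMk]
  exact p.ζA_mem.2.1

/-- **The divisor of the conjugated morphism** = relation (d) of the model Frobenioid for the
comparison
functor: in `Φ^gp(A_D)`, `(cls p)^{deg_Fr φ} · divOf φ = baseOf(φ)^*(cls p') · Div(pathHom φ)`.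
[cite: MochizukiFrdI2008, Thm. 5.2(iv) p.102] -/
theorem gpDiv_pathHom (p : FPPath F P X) (p' : FPPath F P X') (φ : X ⟶ X') :
    cls p ^ (degFr F φ : ℕ) * Algebra.GrothendieckGroup.of (divOf p φ) =
      pullGp Φ (baseOf p p' φ) (cls p') * Birat.gpDiv (pathHom hF hsq p p' φ) := by
  haveI : IsIso (Base F p.ζA) := p.ζA_mem.2.2
  haveI : IsIso (Base F p'.ζA) := p'.ζA_mem.2.2
  haveI : IsIso (Base F p'.ζX) := p'.ζX_mem.2.2
  rw [pathHom_eq, Birat.gpDiv_comp, Birat.gpDiv_comp, Birat.gpDeg_comp, gpDiv_pathIso,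
    gpBase_pathIso,
    gpDiv_pathIsoRev, gpDeg_pathIsoRev, mul_one, Birat.gpDiv_map, Birat.gpBase_map, Birat.gpDeg_map,
    PNat.one_coe, pow_one]
  -- abbreviations
  set zA' := Algebra.GrothendieckGroup.of (M := Φ.obj (op (baseObj F p'.B))) (Div F p'.ζA) with hzA'
  set zX' := Algebra.GrothendieckGroup.of (M := Φ.obj (op (baseObj F p'.B))) (Div F p'.ζX) with hzX'
  have hdv : pullGp Φ (inv (Base F p.ζA) ≫ Base F p.ζX) (Algebra.GrothendieckGroup.of (Div F φ)) =
      Algebra.GrothendieckGroup.of (divOf p φ) := by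
    rw [pullGp_comp, pullGp_of', pullGp_of']
    rfl
  have hZ : pullGp Φ (inv (Base F p.ζA) ≫ Base F p.ζX) (pullGp Φ (Base F φ)
      (pullGp Φ (inv (Base F p'.ζX)) (zA' / zX'))) =
      pullGp Φ (inv (Base F p.ζA) ≫ Base F p.ζX ≫ Base F φ ≫ inv (Base F p'.ζX)) (zA' / zX') := by
    rw [← pullGp_comp, ← pullGp_comp]
    simp only [Category.assoc]
  have hcl : pullGp Φ (baseOf p p' φ) (cls p') =
      pullGp Φ (inv (Base F p.ζA) ≫ Base F p.ζX ≫ Base F φ ≫ inv (Base F p'.ζX)) (zX' / zA') := by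
    rw [cls_eq]
    unfold baseOf
    rw [← pullGp_comp]
    simp only [Category.assoc, IsIso.hom_inv_id, Category.comp_id]
    rw [hzX', hzA']
  have hone : zX' / zA' * (zA' / zX') = 1 := by
    rw [div_mul_div_comm, mul_comm zX' zA', div_self']
  rw [map_mul, hZ, hdv, hcl, ← mul_assoc, ← mul_assoc, ← map_mul, hone, map_one, one_mul, mul_comm]

end FPPath

end PreFrobenioid

end Literature.AlgebraicGeometry.Frobenioids
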